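import Summits.ResolutionOfSingularities.ResolutionOfSingularities.Theses.UniversalCells
import Summits.ResolutionOfSingularities.ResolutionOfSingularities.Theorems.UniversalCellsLocalToGlobalCoverInduction
import Summits.ResolutionOfSingularities.ResolutionOfSingularities.Theorems.UniversalCellsLocalToGlobalExtension
import Summits.ResolutionOfSingularities.ResolutionOfSingularities.Theorems.UniversalCellsLocalToGlobalOpenPatchingOfTwoModelPatching
import Summits.ResolutionOfSingularities.ResolutionOfSingularities.Theorems.UniversalCellsLocalToGlobalTwoModelPatchingAt
import Literature.AlgebraicGeometry.Resolution.SandwichedWeakPatching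
import Literature.AlgebraicGeometry.Morphisms.NagataCompactificationProofs
import Literature.AlgebraicGeometry.Morphisms.OpenGluingProofs
import HarnessLib

/-!
# ResolutionOfSingularities / UniversalCells — crux `LocalToGlobal`: the line `birth` closed
# modulo two-model patching, and the no-slack certificate

Crux `stmt-ResolutionOfSingularities-15232`, decl
`Summit.ResolutionOfSingularities.ResolutionOfSingularities.Theses.UniversalCells.LocalToGlobal`:
`∀ p prime, LocallyResolvable p → GloballyResolvable p` (pointwise Zariski-local resolvability of
every integral separated finite-type `𝔽_p`-scheme ⇒ resolution of every such scheme).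

The line `birth` (`Cruxes/LocalToGlobal/Lines/birth.lean`) cuts the crux into three stubs —
finite-cover induction (`stub_coverInduction`, LANDED: `UniversalCellsLocalToGlobalCoverInduction`),
extension of a local resolution to a partial resolution (`stub_extension`, LANDED:
`UniversalCellsLocalToGlobalExtension`, from the tree's THEOREM `NagataCompactification_holds`), and
Zariski-open patching of two partial resolutions (`stub_openPatching`, the load-bearing stub, OPEN
in dimension `≥ 4`) — with a composition proved by pure logic. This file records, sorry-free:

* `globallyResolvable_of_twoModelPatching`, `localToGlobal_of_twoModelPatching` — **the crux from
  Piltant's two-model patching of proper models** (`ProperModel.TwoModelPatching p`, Zariski 1944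
  p. 539 / Piltant 2013 Prop. 5.1 with `P = P_reg`, the tree's catalogued open core of Zariski's
  programme; open in dimension `≥ 4`, Piltant 2013 p. 2): cover induction + extension + the landed
  `openPatching_of_twoModelPatching`. A CONDITIONAL result (the crux item stays open): it pins the
  crux UNDER the same atom as the dead sibling line `Cruxes/PatchingRel/Lines/sandwiched-gluing`
  of crux `Valuative.PatchingRel` (stmt-0642).
* `localToGlobal_of_sandwichedWeakResolution` — hence also from weak resolution of varieties with
  sandwiched singular locus (`SandwichedWeakResolution p`, equivalent to two-model patching modulo
  Nagata, `sandwichedWeakResolution_iff_twoModelPatching`; Nagata is now a theorem).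
* `localToGlobal_of_resolutionInChar` — and, trivially, from the summit slice
  `∀ p prime, ResolutionInChar p` (the crux's consequent is a case of it): the sanity direction.
* `localToGlobal_iff_twoModelPatchingAt` — **the kill-criterion-(ii) reading of the crux**
  (route header, KILL CRITERIA (ii): "if LocalToGlobal ⇔ Valuative.PatchingRel, the local-to-global
  half merges into Valuative"): prime by prime, `LocalToGlobal` is EQUIVALENT to "pointwise-local
  resolvability over `𝔽_p` ⇒ two-model patching of proper models of every function field over
  `𝔽_p`" — i.e. to Piltant's patching atom over the prime field (the atom at which `PatchingRel`,
  stmt-0642, is parked: `Cruxes/PatchingRel/LINE-STATUS.md`) UNDER the crux's own antecedent. The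
  antecedent is consumed once, by the finite subcover; nothing in the line uses it again.
* `localToGlobal_iff_openPatching` — **the no-slack certificate of the line**: the crux is
  EQUIVALENT to its load-bearing stub `Sig.stub_openPatching` (statement unfolded:
  `∀ p prime, LocallyResolvable p → OpenPatching p`). `←` is the line's composition through the two
  landed stubs; `→` is "a resolution of `X` patches anything". So every proof of the crux is a
  proof of Zariski-open two-model patching over `𝔽_p` under the hypothesis of pointwise-local
  resolvability, and conversely.

## References

* O. Zariski, *Reduction of the singularities of algebraic three dimensional varieties*,
  Ann. of Math. 45 (1944) 472–542, Fundamental Theorem p. 539. [Zariski1944]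
* O. Piltant, *An axiomatic version of Zariski's patching theorem*, RACSAM 107 (2013) 91–121,
  Prop. 5.1 and p. 2. [Piltant2013]
* Y. Hu, arXiv:2109.02968 (2021), p. 65 ("it remains to glue finitely many local resolutions").
  [Hu2021]
-/

-- `Summit.<Summit>.<Sub>.Theorems` with `Sub = Summit` (single-conjunct summit, D-0017)
set_option linter.dupNamespace false

noncomputable section

open CategoryTheory AlgebraicGeometry TopologicalSpace
open Literature.AlgebraicGeometry.Resolution Literature.AlgebraicGeometry.Morphisms
open Summit.ResolutionOfSingularities.ResolutionOfSingularities.Theses.UniversalCells (LocalToGlobal)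

namespace Summit.ResolutionOfSingularities.ResolutionOfSingularities.Theorems

/-- **The crux slice at `p` from two-model patching at `p`**: if `ProperModel.TwoModelPatching p`
holds and every point of every integral separated finite-type `𝔽_p`-scheme has a resolvable open
neighbourhood, then every integral separated finite-type `𝔽_p`-scheme has a resolution
(cover induction `stub_coverInduction` over the binary-union step assembled from `stub_extension`
twice and `openPatching_of_twoModelPatching`). Conditional on the open statement
`TwoModelPatching p` (Piltant 2013, Prop. 5.1, `P = P_reg`; open in dimension `≥ 4`).
[cite: Piltant2013, Prop. 5.1 and p. 2] -/
theorem globallyResolvable_of_twoModelPatching (p : ℕ) (hp : p.Prime)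
    (hT : ProperModel.TwoModelPatching.{0} p)
    (hloc : ∀ (X : Scheme.{0}) (f : X ⟶ Spec (.of (ZMod p))), IsSeparated f →
      LocallyOfFiniteType f → QuasiCompact f → IsIntegral X →
        ∀ x : X, ∃ U : X.Opens, x ∈ U ∧ Scheme.HasResolution (U : Scheme.{0}))
    (X : Scheme.{0}) (f : X ⟶ Spec (.of (ZMod p))) (hs : IsSeparated f)
    (hl : LocallyOfFiniteType f) (hq : QuasiCompact f) (hi : IsIntegral X) :
    Scheme.HasResolution X :=
  stub_coverInduction p hp hloc
    (fun Y g hs' hl' hq' hi' U V hUV hU hV =>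
      openPatching_of_twoModelPatching p hp hT Y g hs' hl' hq' hi' U V hUV
        (stub_extension p hp Y g hs' hl' hq' hi' U hU) (stub_extension p hp Y g hs' hl' hq' hi' V hV))
    X f hs hl hq hi

/-- **`LocalToGlobal` from two-model patching of proper models in every prime characteristic**
(a CONDITIONAL proof of the crux: `∀ p prime, ProperModel.TwoModelPatching p` is open in
dimension `≥ 4`). The local-resolvability antecedent of the crux is used exactly once, through the
finite subcover of `stub_coverInduction`. [cite: Piltant2013, Prop. 5.1 and p. 2] -/
theorem localToGlobal_of_twoModelPatching
    (hT : ∀ p : ℕ, p.Prime → ProperModel.TwoModelPatching.{0} p) : LocalToGlobal :=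
  fun p hp hloc X f hs hl hq hi =>
    globallyResolvable_of_twoModelPatching p hp (hT p hp) hloc X f hs hl hq hi

/-- **`LocalToGlobal` from weak resolution of varieties with sandwiched singular locus in every
prime characteristic** (`SandwichedWeakResolution p ↔ ProperModel.TwoModelPatching p` modulo
Nagata compactification, which is the theorem `NagataCompactification_holds`).
[cite: Piltant2013, Prop. 5.1 and p. 2] -/
theorem localToGlobal_of_sandwichedWeakResolution
    (hS : ∀ p : ℕ, p.Prime → SandwichedWeakResolution.{0} p) : LocalToGlobal :=
  localToGlobal_of_twoModelPatching fun p hp =>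
    (sandwichedWeakResolution_iff_twoModelPatching NagataCompactification_holds).mp (hS p hp)

/-- **`LocalToGlobal` from the summit slice** `∀ p prime, ResolutionInChar p` (sanity direction:
the crux's consequent is the case `k = 𝔽_p`, `X` integral of that statement; the antecedent is
not used). [folklore] -/
theorem localToGlobal_of_resolutionInChar (h : ∀ p : ℕ, p.Prime → ResolutionInChar.{0} p) :
    LocalToGlobal := by
  intro p hp _ X f hs hl hq hi
  haveI : Fact p.Prime := ⟨hp⟩
  haveI := hi
  exact h p hp (ZMod p) X f hs hl hq inferInstance

/-- **No-slack certificate of the line `birth`: the crux `LocalToGlobal` is EQUIVALENT to its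
load-bearing stub** `Sig.stub_openPatching` of `Cruxes/LocalToGlobal/Lines/birth.lean`, i.e. to
"for every prime `p`, under pointwise-local resolvability of all integral separated finite-type
`𝔽_p`-schemes, two proper birational integral models of such an `X = U ∪ V`, regular over `U`
resp. over `V`, patch to a resolution of `X`" (statement unfolded). `→`: a resolution of `X`
exists by the crux and patches anything; `←`: the line's composition through the landed stubs
`stub_extension` (twice) and `stub_coverInduction`. [folklore] -/
theorem localToGlobal_iff_openPatching :
    LocalToGlobal ↔
      ∀ p : ℕ, p.Prime →
        (∀ (X : Scheme.{0}) (f : X ⟶ Spec (.of (ZMod p))), IsSeparated f →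
          LocallyOfFiniteType f → QuasiCompact f → IsIntegral X →
            ∀ x : X, ∃ U : X.Opens, x ∈ U ∧ Scheme.HasResolution (U : Scheme.{0})) →
        ∀ (X : Scheme.{0}) (f : X ⟶ Spec (.of (ZMod p))), IsSeparated f →
          LocallyOfFiniteType f → QuasiCompact f → IsIntegral X → ∀ U V : X.Opens, U ⊔ V = ⊤ →
            (∃ (Z : Scheme.{0}) (π : Z ⟶ X), IsIntegral Z ∧ IsProper π ∧ IsBirational π ∧
              ∀ z : Z, π.base z ∈ U → IsRegularLocalRing (Z.presheaf.stalk z)) →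
            (∃ (Z : Scheme.{0}) (π : Z ⟶ X), IsIntegral Z ∧ IsProper π ∧ IsBirational π ∧
              ∀ z : Z, π.base z ∈ V → IsRegularLocalRing (Z.presheaf.stalk z)) →
              Scheme.HasResolution X :=
  ⟨fun h p hp hloc X f hs hl hq hi _ _ _ _ _ => h p hp hloc X f hs hl hq hi,
    fun h p hp hloc X f hs hl hq hi =>
      stub_coverInduction p hp hloc
        (fun Y g hs' hl' hq' hi' U V hUV hU hV =>
          h p hp hloc Y g hs' hl' hq' hi' U V hUV (stub_extension p hp Y g hs' hl' hq' hi' U hU)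
            (stub_extension p hp Y g hs' hl' hq' hi' V hV))
        X f hs hl hq hi⟩

/-- **Kill-criterion (ii) in Lean: `LocalToGlobal` is, prime by prime, EQUIVALENT to "pointwise
Zariski-local resolvability over `𝔽_p` ⇒ two-model patching of proper models of function fields
over `𝔽_p`"** (Piltant 2013, Prop. 5.1 with `P = P_reg`, over the prime field — the atom of the
sibling crux `Valuative.PatchingRel`). `→`: the crux gives resolution of every integral separated
finite-type `𝔽_p`-scheme, hence of the join of two proper models
(`twoModelPatchingAt_of_globallyResolvable`); `←`: cover induction + extension (the two landed
true stubs) + `hasResolution_of_twoModelPatchingAt_of_cover` at `k = 𝔽_p`.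
[cite: Piltant2013, Prop. 5.1 and p. 2] -/
theorem localToGlobal_iff_twoModelPatchingAt :
    LocalToGlobal ↔
      ∀ (p : ℕ) [Fact p.Prime],
        (∀ (X : Scheme.{0}) (f : X ⟶ Spec (.of (ZMod p))), IsSeparated f →
          LocallyOfFiniteType f → QuasiCompact f → IsIntegral X →
            ∀ x : X, ∃ U : X.Opens, x ∈ U ∧ Scheme.HasResolution (U : Scheme.{0})) →
        ∀ (K : Type) [Field K] [Algebra (ZMod p) K] [Algebra.EssFiniteType (ZMod p) K]
          (M₁ M₂ : ProperModel (ZMod p) K),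
          ∃ (N : ProperModel (ZMod p) K) (φ₁ : N.Hom M₁) (φ₂ : N.Hom M₂), φ₁.RegLe ∧ φ₂.RegLe := by
  constructor
  · intro h p _ hloc K _ _ _ M₁ M₂
    exact twoModelPatchingAt_of_globallyResolvable p (h p Fact.out hloc) K M₁ M₂
  · intro h p hp hloc X f hs hl hq hi
    haveI : Fact p.Prime := ⟨hp⟩
    refine stub_coverInduction p hp hloc (fun Y g hs' hl' hq' hi' U V hUV hU hV => ?_) X f hs hl hq hi
    haveI := hs'; haveI := hl'; haveI := hq'; haveI := hi'
    obtain ⟨Z₁, π₁, hZ₁, hπ₁, hb₁, hr₁⟩ := stub_extension p hp Y g hs' hl' hq' hi' U hU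
    obtain ⟨Z₂, π₂, hZ₂, hπ₂, hb₂, hr₂⟩ := stub_extension p hp Y g hs' hl' hq' hi' V hV
    haveI := hZ₁; haveI := hπ₁; haveI := hZ₂; haveI := hπ₂
    exact hasResolution_of_twoModelPatchingAt_of_cover (k := ZMod p)
      (fun K _ _ _ M₁ M₂ => h p hloc K M₁ M₂) Y g U V hUV π₁ π₂ hb₁ hb₂ hr₁ hr₂

/-- **`LocalToGlobal` from STRONG resolution of sandwiched schemes in every prime characteristic**
(`SandwichedStrongResolution p`: resolution of integral schemes proper-birational over a regular
variety, isomorphic over the regular locus — Cossart–Piltant 2019 Thm. 1.1 (i)–(ii) in dimension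
`≤ 3`, OPEN in dimension `≥ 4`): through `sandwichedWeakResolution_of_sandwichedStrongResolution`,
whose two side inputs, Nagata compactification and two-piece open gluing, are the theorems
`NagataCompactification_holds` and `OpenGluing_holds`. This completes the chain of the tree's
catalogued open cores above the crux: `SAND⁺ ⇒ SANDʷ ⇔ TMP ⇒ LocalToGlobal`.
[cite: CossartPiltant2019, Thm. 1.1 (i)-(ii) (dimension ≤ 3; the general statement is open)] -/
theorem localToGlobal_of_sandwichedStrongResolution
    (hS : ∀ p : ℕ, p.Prime → SandwichedStrongResolution.{0} p) : LocalToGlobal :=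
  localToGlobal_of_sandwichedWeakResolution fun p hp =>
    sandwichedWeakResolution_of_sandwichedStrongResolution NagataCompactification_holds
      OpenGluing_holds (hS p hp)

end Summit.ResolutionOfSingularities.ResolutionOfSingularities.Theorems

end
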